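import Summits.MatrixMultiplication.MatrixMultiplication.Theorems.OutsiderSandwichLevelOne
import Summits.MatrixMultiplication.MatrixMultiplication.Theorems.OutsiderSandwichLevelLaw
import Summits.MatrixMultiplication.MatrixMultiplication.Theorems.OutsiderSandwichNoPadding
import HarnessLib

/-!
# The catalytic level-one law: `⟨B⟩ ⊠ C₁ ⊵ ⟨m⟩ ⊠ ⟨2,2,2⟩ ⊕ ⟨k⟩ ⊠ C₁ ⟺ 3m + 2k ≤ 2B`

Route `OutsiderSandwich` (decomposition cell `decomp-mm`, lens 4 «minimal counterexample /
extremal reduction», gen 28, addendum), support for the aside leaf `BlockOneIsMM`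
(stmt-MatrixMultiplication-27147).

**Theorem** (`catalytic_iff`).  For all `B, m, k`,
`m·[⟨2,2,2⟩] + k·[C₁] ≤ B·[C₁]` in the tensor semiring `T(ℂ)` (equivalently
`⟨B⟩ ⊠ C₁ ⊵ ⟨m⟩ ⊠ ⟨2,2,2⟩ ⊕ ⟨k⟩ ⊠ C₁`, `catalytic_restrictsTo_iff`) **iff** `3m + 2k ≤ 2B`.
So coupled blocks handed back are never partially refunded at level one: `k` catalytic copies
of `C₁` cost exactly `k` source blocks on top of the level-one price `⌈3m/2⌉`
(`OutsiderSandwichLevelOne.amortisedNumber_one`).  This contains the no-catalysis theorem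
(`OutsiderSandwichNoCatalysis.not_catalytic`, `B = m + k`) and the level-one law (`k = 0`) as the
extreme cases; e.g. `⟨5⟩ ⊠ C₁ ⋭ ⟨3⟩ ⊠ ⟨2,2,2⟩ ⊕ C₁` (`not_three_with_catalyst`).

Proof.  The partial-weight transport of `OutsiderSandwichPartialWeights` applied to the target
`t = ⟨m⟩ ⊠ ⟨2,2,2⟩♭ ⊕ ⟨k⟩ ⊠ P` (formats `4m + 4k`) gives a weight space `W` with
`dim W ≥ 8m + 8k − 4B` and a linear `Y`, injective on `W`, killed by the slices.  Slices of a
direct sum are block diagonal, so the flat component still satisfies `V_i · Y_i = 0`; the `2 × 2`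
core lemma bounds each flat block pair by `4`, while the `C₁`-component is only bounded by its
format `4k` on each side.  The two injections `W ↪ ∏ range(V_i) × ℂ^{4k}` and
`W ↪ ∏ range(Y_i) × ℂ^{4k}` give `2 dim W ≤ 4m + 8k`, whence `12m + 8k ≤ 8B`.  The converse is
the 3:2 yield plus `k` identity blocks.

## References
* D. Coppersmith, S. Winograd, *Matrix multiplication via arithmetic progressions*,
  J. Symbolic Comput. 9 (1990) 251–280, §7 (the coupled block `C₁`). [CoppersmithWinograd1990]
* P. Bürgisser, M. Clausen, M. A. Shokrollahi, *Algebraic Complexity Theory*, Springer (1997),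
  §14.4, §17.1 (restriction, conciseness, substitution). [BurgisserClausenShokrollahi1997]
-/

noncomputable section
open scoped BigOperators Matrix
set_option linter.dupNamespace false
set_option autoImplicit false

namespace Summit.MatrixMultiplication.MatrixMultiplication.Theorems.OutsiderSandwichCatalyticLaw

open Literature.Computability.AlgebraicComplexity
open Summit.MatrixMultiplication.MatrixMultiplication.Theorems.OutsiderSandwichNoTightExchange
open Summit.MatrixMultiplication.MatrixMultiplication.Theorems.OutsiderSandwichCoupling (coupling₁)
open Summit.MatrixMultiplication.MatrixMultiplication.Theorems.OutsiderSandwichBlockNormalForm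
open Summit.MatrixMultiplication.MatrixMultiplication.Theorems.OutsiderSandwichAmortised
open Summit.MatrixMultiplication.MatrixMultiplication.Theorems.OutsiderSandwichSliceConcise
open Summit.MatrixMultiplication.MatrixMultiplication.Theorems.OutsiderSandwichNoPadding
open Summit.MatrixMultiplication.MatrixMultiplication.Theorems.OutsiderSandwichPartialWeights
open Summit.MatrixMultiplication.MatrixMultiplication.Theorems.OutsiderSandwichCoreTwoByTwo
open Summit.MatrixMultiplication.MatrixMultiplication.Theorems.OutsiderSandwichLevelOne
open Summit.MatrixMultiplication.MatrixMultiplication.Theorems.OutsiderSandwichLevelLaw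

/-! ## 1. The block count with a free summand -/

/-- **Block count with a free summand.**  If `U` carries block maps `p_i, q_i : U → M₂(ℂ)` with
`dim range p_i + dim range q_i ≤ c`, and maps `E₁, E₂ : U → X` such that `(p, E₁)` and `(q, E₂)`
are jointly injective, then `2 dim U ≤ m c + 2 dim X`.
[cite: BurgisserClausenShokrollahi1997, §17.1] -/
theorem two_mul_finrank_le_of_maps {U X : Type} [AddCommGroup U] [Module ℂ U]
    [FiniteDimensional ℂ U] [AddCommGroup X] [Module ℂ X] [FiniteDimensional ℂ X] {m c : ℕ}
    (p q : Fin m → (U →ₗ[ℂ] Matrix (Fin 2) (Fin 2) ℂ)) (E₁ E₂ : U →ₗ[ℂ] X)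
    (h₁ : ∀ u, (∀ i, p i u = 0) → E₁ u = 0 → u = 0)
    (h₂ : ∀ u, (∀ i, q i u = 0) → E₂ u = 0 → u = 0)
    (hc : ∀ i, Module.finrank ℂ (LinearMap.range (p i)) +
      Module.finrank ℂ (LinearMap.range (q i)) ≤ c) :
    2 * Module.finrank ℂ U ≤ m * c + 2 * Module.finrank ℂ X := by
  classical
  have key : ∀ (r : Fin m → (U →ₗ[ℂ] Matrix (Fin 2) (Fin 2) ℂ)) (E : U →ₗ[ℂ] X),
      (∀ u, (∀ i, r i u = 0) → E u = 0 → u = 0) →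
      Module.finrank ℂ U ≤
        ∑ i, Module.finrank ℂ (LinearMap.range (r i)) + Module.finrank ℂ X := by
    intro r E hE
    let Φ : U →ₗ[ℂ] ((i : Fin m) → LinearMap.range (r i)) × X :=
      (LinearMap.pi fun i => (r i).rangeRestrict).prod E
    have hΦ : Function.Injective Φ := by
      refine (injective_iff_map_eq_zero Φ).2 fun u hu => ?_
      have hu' : ((LinearMap.pi fun i => (r i).rangeRestrict) u, E u) = (0 : _ × X) := hu
      rw [Prod.mk_eq_zero] at hu'
      refine hE u (fun i => ?_) hu'.2
      have e := congrFun hu'.1 i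
      rw [LinearMap.pi_apply, Pi.zero_apply] at e
      have e' := congrArg Subtype.val e
      rw [LinearMap.codRestrict_apply] at e'
      exact e'
    have e := LinearMap.finrank_le_finrank_of_injective hΦ
    rw [Module.finrank_prod, Module.finrank_pi_fintype ℂ] at e
    exact e
  have e₁ := key p E₁ h₁
  have e₂ := key q E₂ h₂
  have hsum : ∑ i : Fin m, (Module.finrank ℂ (LinearMap.range (p i)) +
      Module.finrank ℂ (LinearMap.range (q i))) ≤ ∑ _i : Fin m, c :=
    Finset.sum_le_sum fun i _ => hc i
  rw [Finset.sum_add_distrib, Finset.sum_const, Finset.card_univ, Fintype.card_fin,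
    smul_eq_mul] at hsum
  omega

/-! ## 2. The catalytic law -/

/-- **Catalytic level-one law** (decoded form): `⟨B⟩ ⊠ P ⊵ ⟨m⟩ ⊠ ⟨2,2,2⟩ ⊕ ⟨k⟩ ⊠ P ⟹
3m + 2k ≤ 2B`. [cite: CoppersmithWinograd1990, §7] -/
theorem catalytic_src {B m k : ℕ}
    (h : TensorRestrictsTo (src 1 B) (directSumTensor (tgt 1 m) (src 1 k))) :
    3 * m + 2 * k ≤ 2 * B := by
  classical
  -- pass to the flat model of `⟨m⟩ ⊠ ⟨2,2,2⟩` inside the direct sum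
  have hflat : TensorRestrictsTo (src 1 B)
      (directSumTensor (OutsiderSandwichLevelOne.flat m) (src 1 k)) := by
    have h1 : TensorClass.mk (directSumTensor (OutsiderSandwichLevelOne.flat m) (src 1 k)) ≤
        TensorClass.mk (directSumTensor (tgt 1 m) (src 1 k)) := by
      rw [← TensorClass.mk_add_mk, ← TensorClass.mk_add_mk]
      exact TensorClass.add_le_add (TensorClass.mk_le_mk_iff.2 (tgt_restrictsTo_flat m)) le_rfl
    exact TensorClass.mk_le_mk_iff.1 (h1.trans (TensorClass.mk_le_mk_iff.2 h))
  obtain ⟨W, Y, hdim, hinj, hann⟩ := exists_partial_weights (le_refl 1)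
    (t := directSumTensor (OutsiderSandwichLevelOne.flat m) (src 1 k))
    (fun w hw => directSum_weight_eq_zero (flat_weight_eq_zero m)
      (fun w' hw' => src_weight_eq_zero 1 k hw') hw)
    (fun ζ hζ => directSum_vec_eq_zero (flat_vec_eq_zero m)
      (fun ζ' hζ' => src_vec_eq_zero 1 k hζ') hζ)
    hflat
  -- the flat component of the annihilation `S_w · Y(w) = 0`
  have hflat0 : ∀ u ∈ W,
      (slice (OutsiderSandwichLevelOne.flat m) fun b => u (Sum.inl b)).mulVec
        (Y u ∘ Sum.inl) = 0 := by
    intro u hu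
    have e := hann u hu
    rw [slice_directSum, Matrix.fromBlocks_mulVec] at e
    funext a
    have ea := congrFun e (Sum.inl a)
    simp only [Sum.elim_inl, Matrix.zero_mulVec, add_zero, Pi.zero_apply] at ea ⊢
    exact ea
  -- the block maps on `W`
  let V := (Fin m × (Fin 2 × Fin 2)) ⊕ J 1 k
  let πl : (V → ℂ) →ₗ[ℂ] (Fin m × (Fin 2 × Fin 2) → ℂ) := LinearMap.funLeft ℂ ℂ Sum.inl
  let πr : (V → ℂ) →ₗ[ℂ] (J 1 k → ℂ) := LinearMap.funLeft ℂ ℂ Sum.inr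
  let Θ : (Fin m × (Fin 2 × Fin 2) → ℂ) →ₗ[ℂ] (Fin m → Matrix (Fin 2) (Fin 2) ℂ) :=
    (blocks m : _ →ₗ[ℂ] _)
  let p : Fin m → (W →ₗ[ℂ] Matrix (Fin 2) (Fin 2) ℂ) :=
    fun i => (LinearMap.proj i).comp (Θ.comp (πl.comp W.subtype))
  let q : Fin m → (W →ₗ[ℂ] Matrix (Fin 2) (Fin 2) ℂ) :=
    fun i => (LinearMap.proj i).comp (Θ.comp (πl.comp (Y.comp W.subtype)))
  let E₁ : W →ₗ[ℂ] (J 1 k → ℂ) := πr.comp W.subtype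
  let E₂ : W →ₗ[ℂ] (J 1 k → ℂ) := πr.comp (Y.comp W.subtype)
  have hp : ∀ i (u : W), p i u = blocks m (fun b => (u : V → ℂ) (Sum.inl b)) i :=
    fun _ _ => rfl
  have hq : ∀ i (u : W), q i u = blocks m (fun b => Y (u : V → ℂ) (Sum.inl b)) i :=
    fun _ _ => rfl
  have hE₁ : ∀ (u : W) (c : J 1 k), E₁ u c = (u : V → ℂ) (Sum.inr c) := fun _ _ => rfl
  have hE₂ : ∀ (u : W) (c : J 1 k), E₂ u c = Y (u : V → ℂ) (Sum.inr c) := fun _ _ => rfl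
  have hpq : ∀ i (u : W), p i u * q i u = 0 := fun i u => by
    rw [hp, hq]
    ext r c
    rw [blocks_mul_blocks, Matrix.zero_apply]
    exact congrFun (hflat0 u u.2) (i, (r, c))
  have hcore : ∀ i, Module.finrank ℂ (LinearMap.range (p i)) +
      Module.finrank ℂ (LinearMap.range (q i)) ≤ 4 :=
    fun i => finrank_range_add_le_four (p i) (q i) (hpq i)
  have h₁ : ∀ u : W, (∀ i, p i u = 0) → E₁ u = 0 → u = 0 := by
    intro u hpu hEu
    have hl : (fun b => (u : V → ℂ) (Sum.inl b)) = 0 := by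
      have hb : blocks m (fun b => (u : V → ℂ) (Sum.inl b)) = 0 :=
        funext fun i => by rw [← hp]; exact hpu i
      exact (LinearEquiv.map_eq_zero_iff _).1 hb
    apply Subtype.ext
    show (u : V → ℂ) = 0
    funext x
    rcases x with b | c
    · exact congrFun hl b
    · rw [← hE₁, hEu]; rfl
  have h₂ : ∀ u : W, (∀ i, q i u = 0) → E₂ u = 0 → u = 0 := by
    intro u hqu hEu
    have hl : (fun b => Y (u : V → ℂ) (Sum.inl b)) = 0 := by
      have hb : blocks m (fun b => Y (u : V → ℂ) (Sum.inl b)) = 0 :=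
        funext fun i => by rw [← hq]; exact hqu i
      exact (LinearEquiv.map_eq_zero_iff _).1 hb
    apply Subtype.ext
    show (u : V → ℂ) = 0
    refine hinj u u.2 ?_
    funext x
    rcases x with b | c
    · exact congrFun hl b
    · rw [← hE₂, hEu]; rfl
  have hcount := two_mul_finrank_le_of_maps p q E₁ E₂ h₁ h₂ hcore
  -- dimensions
  have hX : Module.finrank ℂ (J 1 k → ℂ) = 4 * k := by
    rw [Module.finrank_fintype_fun_eq_card, card_J]; ring
  have hin : Fintype.card V = 4 * m + 4 * k := by
    simp only [V, J, Fintype.card_sum, Fintype.card_prod, Fintype.card_fun, Fintype.card_fin]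
    ring
  have hB : Fintype.card (J 1 B) = 4 * B := by rw [card_J]; ring
  rw [hX] at hcount
  rw [hB] at hdim
  have hdim' : (4 * m + 4 * k) + (4 * m + 4 * k) ≤
      Module.finrank ℂ W + 4 * B := by rw [← hin]; exact hdim
  omega

/-- **`⟨5⟩ ⊠ P ⋭ ⟨3⟩ ⊠ ⟨2,2,2⟩ ⊕ ⟨1⟩ ⊠ P`**: one catalytic block does not bring the price of
three products below `a(1,3) + 1 = 6`. [cite: CoppersmithWinograd1990, §7] -/
theorem not_three_with_catalyst :
    ¬ TensorRestrictsTo (src 1 5) (directSumTensor (tgt 1 3) (src 1 1)) :=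
  fun h => absurd (catalytic_src h) (by norm_num)

/-! ## 3. Semiring and restriction forms -/

/-- **Catalytic level-one law** (semiring form): `m·[⟨2,2,2⟩] + k·[C₁] ≤ B·[C₁]` in `T(ℂ)` iff
`3m + 2k ≤ 2B`. [cite: CoppersmithWinograd1990, §7] -/
theorem catalytic_iff (B m k : ℕ) :
    (m : TensorClass ℂ) * TensorClass.mk (matMulTensor ℂ 2 2 2) +
        (k : TensorClass ℂ) * TensorClass.mk coupling₁ ≤
      (B : TensorClass ℂ) * TensorClass.mk coupling₁ ↔ 3 * m + 2 * k ≤ 2 * B := by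
  classical
  constructor
  · intro h
    rw [← pow_one (TensorClass.mk (matMulTensor ℂ 2 2 2)), ← pow_one (TensorClass.mk coupling₁),
      mk_coupling₁, ← mk_unit_kronecker_pow (matMulTensor ℂ 2 2 2) m 1,
      ← mk_unit_kronecker_pow (pairTensor 2) k 1, ← mk_unit_kronecker_pow (pairTensor 2) B 1,
      TensorClass.mk_add_mk, TensorClass.mk_le_mk_iff] at h
    exact catalytic_src h
  · intro h
    obtain ⟨B', rfl⟩ : ∃ B', B = k + B' := Nat.exists_eq_add_of_le (by omega)
    have h1 : (m : TensorClass ℂ) * TensorClass.mk (matMulTensor ℂ 2 2 2) ≤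
        (B' : TensorClass ℂ) * TensorClass.mk coupling₁ := (level_one_iff B' m).2 (by omega)
    calc (m : TensorClass ℂ) * TensorClass.mk (matMulTensor ℂ 2 2 2) +
          (k : TensorClass ℂ) * TensorClass.mk coupling₁
        ≤ (B' : TensorClass ℂ) * TensorClass.mk coupling₁ +
          (k : TensorClass ℂ) * TensorClass.mk coupling₁ := TensorClass.add_le_add h1 le_rfl
      _ = ((k + B' : ℕ) : TensorClass ℂ) * TensorClass.mk coupling₁ := by push_cast; ring

/-- **Catalytic level-one law** (restriction form):
`⟨B⟩ ⊠ C₁ ⊵ ⟨m⟩ ⊠ ⟨2,2,2⟩ ⊕ ⟨k⟩ ⊠ C₁ ⟺ 3m + 2k ≤ 2B`. [cite: CoppersmithWinograd1990, §7] -/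
theorem catalytic_restrictsTo_iff (B m k : ℕ) :
    TensorRestrictsTo (kroneckerTensor (unitTensor ℂ B) coupling₁)
        (directSumTensor (kroneckerTensor (unitTensor ℂ m) (matMulTensor ℂ 2 2 2))
          (kroneckerTensor (unitTensor ℂ k) coupling₁)) ↔ 3 * m + 2 * k ≤ 2 * B := by
  classical
  rw [← catalytic_iff, ← TensorClass.mk_le_mk_iff, ← TensorClass.mk_add_mk,
    ← TensorClass.mk_mul_mk, ← TensorClass.mk_mul_mk, ← TensorClass.mk_mul_mk,
    ← TensorClass.natCast_eq_mk, ← TensorClass.natCast_eq_mk, ← TensorClass.natCast_eq_mk]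

end Summit.MatrixMultiplication.MatrixMultiplication.Theorems.OutsiderSandwichCatalyticLaw
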